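import Summits.BirchSwinnertonDyer.BirchSwinnertonDyer.Theorems.ResidualThetaTransportAtTwoResidualSignedLambdaLowerCMAtTwoRhoLayerPairingProjection
import Literature.NumberTheory.GaloisRepresentations.CyclotomicTowerLocalLayerCover
import HarnessLib

/-!
# K-d (b), generic part: the projection formula (P1) across layers at a place `v` where the layer cosets are COVERED
# by the decomposition group (`hcov`) — the `hv : v ∣ p`-free twins of K-c §1, and `hcov` at EVERY finite `v` from `n₀(v)` on

Route `ResidualThetaTransportAtTwo` (RTT), crux RSL_g `ResidualSignedLambdaLowerCMAtTwo` (stmt-BirchSwinnertonDyer-22608); width seat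
`prover-bsd-wall-tp2-p2x-w2` g17 (`--supports`, closes nothing). THEOREMS ONLY (no definition, no named fact, no instance, no `sorry`). BSD is
not proved by any of this; RSL_g is not proved here. Item K-d of `Cruxes/ResidualThetaCountLowerPureAtTwo/STUB-PLAN-stub_cmLambdaLower.md` rev 13
S51 / V55 («K-d is ≈ 80 % in the tree»): the ONLY use of `hv : (p : 𝓞 ℚ) ∈ v.asIdeal` in K-c §1 (`ThetaTransport.layerLocOf_layerCores`,
`ThetaTransport.layerPairingOf_layerCores`, p679036) is through `LocalCores.map_resGalSubgroupOfEmb_layerCores_cyclotomic`, whose generic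
form `LocalCores.map_resGalSubgroupOfEmb_layerCores ι κ T n hcov` (TP2, `…LocalCoresCompat.lean`) needs only the ONE-COSET hypothesis

  `hcov : ∀ u ∈ Γ_n, ∃ t ∈ U_{n,v}, (res_v t)⁻¹ u ∈ Γ_{n+1}`   (`U_{n,v} = layerGroup κ v n`, `res_v = resGalOfEmb (closureEmb ℚ_v)`).

* §1 `layerLocOf_layerCores_of_cov`, **`layerPairingOf_layerCores_of_cov`** — K-c §1 with `hv ↦ hcov`:
  `loc_n(cor x) = cor_{U_{n+1} → U_n}(loc_{n+1} x)` and `⟨loc_n(cor x), y⟩_{n,N} = ⟨loc_{n+1} x, res y⟩_{n+1,N}` for ANY finite `v` and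
  ANY discrete coefficient module `M` (same Shapiro assembly: `cohomologyMap_coindFinSum_shapiroLift`, `ContPairing.cupProduct_coindFinSum_left`,
  `cohomologyMap_coindFinRes_shapiroLift`).
* §2 **`exists_forall_cov_of_isCyclotomic`** — for the CYCLOTOMIC `ℤ_p`-extension and EVERY finite `v`, `hcov` holds at all layers
  `n ≥ n₀(v)` (`v` is finitely decomposed in `ℚ_∞`: the Literature lemma
  `exists_forall_layerSubgroup_exists_apply_resGalOfEmb_eq_of_isCyclotomic` = `hsurj_w`, fed to TP2's `forall_exists_layer_of_surjective`);
  hence `exists_forall_layerLocOf_layerCores` / **`exists_forall_layerPairingOf_layerCores`**: (P1) at `v` for all `n ≥ n₀(v)` UNCONDITIONALLY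
  (at `v ∣ p`, `n₀ = 0` and this is K-c's `layerPairingOf_layerCores`).

Left to the lead's `…RhoLayerPairingProjectionAwayTwo` (K-d proper, S51): the `ρ`-instantiation at `ρM := cofreeTorsionGaloisModule S ρ (2^k)`
(`rhoLayerPairingPk/Adic` at `w ∤ 2`, no points / no Θ-Kummer on the `S₀` side), `locd_w`, the vanishing clause (c) and the conjugate-coset
versions (U43).

References: [Kobayashi2003] (8.23) (p. 18); [PerrinRiou1994Invent] §3.6.1; [Kato2004Asterisque] §12.2 (p. 220); [NeukirchSchmidtWingberg2008]
I §5 Prop. (1.5.3)(iv), (1.5.6)–(1.5.7); [GreenbergLNM1716] §1; [SerreGaloisCohomology1997] II §4.4 Lemme 1.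
-/

set_option autoImplicit false
-- the Theorems namespace of this sub repeats the summit name by design (D-0017 nested layout)
set_option linter.dupNamespace false

noncomputable section

open scoped Classical

namespace Summit.BirchSwinnertonDyer.BirchSwinnertonDyer.Theorems.ThetaTransport

open CategoryTheory Field NumberField IsDedekindDomain
  Literature.NumberTheory.EllipticCurves Literature.NumberTheory.GaloisRepresentations
  Literature.NumberTheory.EllipticCurves.Kobayashi2003
  Literature.NumberTheory.EllipticCurves.GreenbergSelmer Literature.NumberTheory.EllipticCurves.CyclotomicLayer
  Literature.NumberTheory.EllipticCurves.Kato2004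
  Literature.NumberTheory.GaloisCohomology ZpExtension


/-! ## §1 Generic coefficients, `hcov` in place of `v ∣ p` -/

section GenericCov

variable {p : ℕ} [Fact p.Prime] {M : Type} [AddCommGroup M] [TopologicalSpace M] [DiscreteTopology M]
  (ρM : DiscreteGaloisModule ℚ M) (N : ℕ) [NeZero N]
  (e : M → M → AlgebraicClosure ℚ)
  (hμ : ∀ S T, e S T ^ N = 1)
  (hadd₁ : ∀ S₁ S₂ T, e (S₁ + S₂) T = e S₁ T * e S₂ T)
  (hadd₂ : ∀ S T₁ T₂, e S (T₁ + T₂) = e S T₁ * e S T₂)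
  (hgal : ∀ (σ : absoluteGaloisGroup ℚ) (S T : M), σ • e S T = e (ρM σ S) (ρM σ T))
  (κ : ZpExtension ℚ p) (v : HeightOneSpectrum (𝓞 ℚ))

omit [NeZero N] in
/-- **Localisation carries Kato's trace map to the local corestriction, ONE-COSET hypothesis** (any finite `v`, any discrete `M`):
if every coset of `Γ_{n+1}` in `Γ_n` meets `res_v(U_{n,v})` (`hcov`), then `loc_n (layerCores y) = cor_{U_{n+1} → U_n} (loc_{n+1} y)` —
TP2's generic `LocalCores.map_resGalSubgroupOfEmb_layerCores` in the Literature dialect `layerLocOf` (K-c's `layerLocOf_layerCores` is the case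
`v ∣ p`, where `hcov` holds at every `n`). [cite: Kato2004Asterisque, §12.2 (p. 220)] [cite: NeukirchSchmidtWingberg2008, I §5 Prop. (1.5.6)–(1.5.7)] -/
theorem layerLocOf_layerCores_of_cov (n : ℕ)
    [Fintype (layerGroup κ v n ⧸ (layerGroup κ v (n + 1)).subgroupOf (layerGroup κ v n))]
    (hcov : ∀ u ∈ κ.layerSubgroup n, ∃ t ∈ localSubgroupOfEmb (κ.layerSubgroup n) (closureEmb (K := ℚ) (v.adicCompletion ℚ)),
      (resGalOfEmb (closureEmb (K := ℚ) (v.adicCompletion ℚ)) t)⁻¹ * u ∈ κ.layerSubgroup (n + 1))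
    (y : H1 ρM (κ.layerSubgroup (n + 1))) :
    layerLocOf ρM κ v n (layerCores ρM κ n y) =
      coresLe (localRepOf ρM v) (SignedKatoOffTwo.LayerPairing.layerGroup_antitone κ v n) (isOpen_layerGroup κ v (n + 1))
        (layerLocOf ρM κ v (n + 1) y) :=
  SignedKatoOffTwo.LocalCores.map_resGalSubgroupOfEmb_layerCores (closureEmb (K := ℚ) (v.adicCompletion ℚ)) κ ρM n hcov y

/-- **(P1) modulo `N`, generic coefficients, ONE-COSET hypothesis — the projection formula across layers at ANY finite `v`**: under `hcov`
at layer `n`, for `x ∈ H¹(Γ_{n+1}, M)` and a local class `y ∈ H¹(U_n, M|)`,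
`⟨loc_n(cor x), y⟩_{n,N} = ⟨loc_{n+1} x, res_{U_{n+1}}^{U_n} y⟩_{n+1,N}`. Assembly VERBATIM as K-c's `layerPairingOf_layerCores`
(`layerLocOf_layerCores_of_cov`; `cohomologyMap_coindFinSum_shapiroLift`; `ContPairing.cupProduct_coindFinSum_left`; `cohomologyMap_coindFinRes_shapiroLift`).
[cite: Kobayashi2003, (8.23) (p. 18)] [cite: PerrinRiou1994Invent, §3.6.1] [cite: NeukirchSchmidtWingberg2008, I §5 Prop. (1.5.3)(iv)] -/
theorem layerPairingOf_layerCores_of_cov (n : ℕ)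
    (hcov : ∀ u ∈ κ.layerSubgroup n, ∃ t ∈ localSubgroupOfEmb (κ.layerSubgroup n) (closureEmb (K := ℚ) (v.adicCompletion ℚ)),
      (resGalOfEmb (closureEmb (K := ℚ) (v.adicCompletion ℚ)) t)⁻¹ * u ∈ κ.layerSubgroup (n + 1))
    (x : H1 ρM (κ.layerSubgroup (n + 1)))
    (y : continuousCohomology 1 (subgroupRep (localRepOf ρM v) (layerGroup κ v n))) :
    layerPairingOf ρM N e hμ hadd₁ hadd₂ hgal κ v n (layerCores ρM κ n x) y =
      layerPairingOf ρM N e hμ hadd₁ hadd₂ hgal κ v (n + 1) x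
        (resLe (localRepOf ρM v) (SignedKatoOffTwo.LayerPairing.layerGroup_antitone κ v n) 1 y) := by
  haveI : CompactSpace (absoluteGaloisGroup (v.adicCompletion ℚ)) := absoluteGaloisGroup_compactSpace _
  letI : Fintype (absoluteGaloisGroup (v.adicCompletion ℚ) ⧸ layerGroup κ v n) := layerFintypeQuot κ v n
  letI : Fintype (absoluteGaloisGroup (v.adicCompletion ℚ) ⧸ layerGroup κ v (n + 1)) := layerFintypeQuot κ v (n + 1)
  haveI : (layerGroup κ v (n + 1)).FiniteIndex := finiteIndex_of_isOpen_of_compactSpace _ (isOpen_layerGroup κ v (n + 1))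
  haveI : Fintype (layerGroup κ v n ⧸ (layerGroup κ v (n + 1)).subgroupOf (layerGroup κ v n)) := Fintype.ofFinite _
  rw [layerPairingOf_apply, layerPairingOf_apply, layerPairingH1Of_apply, layerPairingH1Of_apply,
    layerLocOf_layerCores_of_cov ρM κ v n hcov x]
  unfold layerShapiroOf layerSumPairingOf
  rw [← cohomologyMap_coindFinSum_shapiroLift (localRepOf ρM v) (SignedKatoOffTwo.LayerPairing.layerGroup_antitone κ v n)
      (isOpen_layerGroup κ v n) (isOpen_layerGroup κ v (n + 1)) (layerReps_spec κ v n) (layerReps_one κ v n) (layerReps_spec κ v (n + 1))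
      (layerReps_one κ v (n + 1)),
    ← cohomologyMap_id_muLocalRep' N v (ContPairing.cupProduct _ _ _),
    ContPairing.cupProduct_coindFinSum_left,
    cohomologyMap_coindFinRes_shapiroLift (localRepOf ρM v) (SignedKatoOffTwo.LayerPairing.layerGroup_antitone κ v n)
      (isOpen_layerGroup κ v n) (isOpen_layerGroup κ v (n + 1)) (layerReps_spec κ v n) (layerReps_one κ v n) (layerReps_spec κ v (n + 1))
      (layerReps_one κ v (n + 1))]

/-! ## §2 The cyclotomic tower: `hcov` at EVERY finite place from `n₀(v)` on, and (P1) there -/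

/-- **`hcov` at every finite place for the cyclotomic `ℤ_p`-extension, from the layer `n₀(v)` on**: `v` is finitely decomposed in `ℚ_∞`
(Literature `exists_forall_layerSubgroup_exists_apply_resGalOfEmb_eq_of_isCyclotomic`, = `hsurj_w` of STUB-PLAN S51), so for `n ≥ n₀(v)` every
coset of `Γ_{n+1}` in `Γ_n` meets `res_v(U_{n,v})` (TP2's `forall_exists_layer_of_surjective`). [cite: GreenbergLNM1716, §1]
[cite: SerreGaloisCohomology1997, II §4.4 Prop. 13 (Lemme 1)] [cite: Kobayashi2003, §2 (p. 4)] -/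
theorem exists_forall_cov_of_isCyclotomic (hκ : κ.IsCyclotomic) :
    ∃ n₀ : ℕ, ∀ n, n₀ ≤ n → ∀ u ∈ κ.layerSubgroup n,
      ∃ t ∈ localSubgroupOfEmb (κ.layerSubgroup n) (closureEmb (K := ℚ) (v.adicCompletion ℚ)),
        (resGalOfEmb (closureEmb (K := ℚ) (v.adicCompletion ℚ)) t)⁻¹ * u ∈ κ.layerSubgroup (n + 1) := by
  obtain ⟨n₀, h⟩ := exists_forall_layerSubgroup_exists_apply_resGalOfEmb_eq_of_isCyclotomic ℚ p hκ v
  exact ⟨n₀, fun n hn ↦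
    SignedKatoOffTwo.LocalCores.forall_exists_layer_of_surjective (closureEmb (K := ℚ) (v.adicCompletion ℚ)) κ n (h n hn)⟩

omit [NeZero N] in
/-- **Localisation carries Kato's trace to the local corestriction at EVERY finite `v`, for all `n ≥ n₀(v)`** (cyclotomic tower).
[cite: Kato2004Asterisque, §12.2 (p. 220)] [cite: GreenbergLNM1716, §1] -/
theorem exists_forall_layerLocOf_layerCores (hκ : κ.IsCyclotomic) :
    ∃ n₀ : ℕ, ∀ n, n₀ ≤ n →
      ∀ [Fintype (layerGroup κ v n ⧸ (layerGroup κ v (n + 1)).subgroupOf (layerGroup κ v n))]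
        (y : H1 ρM (κ.layerSubgroup (n + 1))),
        layerLocOf ρM κ v n (layerCores ρM κ n y) =
          coresLe (localRepOf ρM v) (SignedKatoOffTwo.LayerPairing.layerGroup_antitone κ v n) (isOpen_layerGroup κ v (n + 1))
            (layerLocOf ρM κ v (n + 1) y) := by
  obtain ⟨n₀, h⟩ := exists_forall_cov_of_isCyclotomic κ v hκ
  exact ⟨n₀, fun n hn _ y ↦ layerLocOf_layerCores_of_cov ρM κ v n (h n hn) y⟩

/-- **(P1) modulo `N` at EVERY finite `v`, for all layers `n ≥ n₀(v)`** (cyclotomic tower, any discrete `M`):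
`⟨loc_n(cor x), y⟩_{n,N} = ⟨loc_{n+1} x, res y⟩_{n+1,N}`. At `v ∣ p` this holds with `n₀ = 0` (K-c `layerPairingOf_layerCores`); at
`w ∈ S₀` it is the projection formula feeding `locd_w` (K-d). [cite: Kobayashi2003, (8.23) (p. 18)] [cite: PerrinRiou1994Invent, §3.6.1]
[cite: GreenbergLNM1716, §1] -/
theorem exists_forall_layerPairingOf_layerCores (hκ : κ.IsCyclotomic) :
    ∃ n₀ : ℕ, ∀ n, n₀ ≤ n → ∀ (x : H1 ρM (κ.layerSubgroup (n + 1)))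
      (y : continuousCohomology 1 (subgroupRep (localRepOf ρM v) (layerGroup κ v n))),
      layerPairingOf ρM N e hμ hadd₁ hadd₂ hgal κ v n (layerCores ρM κ n x) y =
        layerPairingOf ρM N e hμ hadd₁ hadd₂ hgal κ v (n + 1) x
          (resLe (localRepOf ρM v) (SignedKatoOffTwo.LayerPairing.layerGroup_antitone κ v n) 1 y) := by
  obtain ⟨n₀, h⟩ := exists_forall_cov_of_isCyclotomic κ v hκ
  exact ⟨n₀, fun n hn x y ↦ layerPairingOf_layerCores_of_cov ρM N e hμ hadd₁ hadd₂ hgal κ v n (h n hn) x y⟩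

end GenericCov

end Summit.BirchSwinnertonDyer.BirchSwinnertonDyer.Theorems.ThetaTransport

end
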